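import Summits.HodgeConjecture.HodgeConjecture.Theorems.K2E1bArchPacketSignsDefs   -- ★ U8 defs leaf: `HasArchOpTrace`, `IsArchTestU21`, frames of unit U8
import Literature.NumberTheory.Automorphic.CompactGroupKFiniteVectors              -- ★ `leftTranslate` (the tree's left-translation currency)
import HarnessLib

/-!
# K2 ∕ E1b tier 1 · unit U8e «CD PSEUDO-COEFFICIENT PARTS» — THEOREMS-SIDE DEFS LEAF of `Cruxes/H413/Lines/K2_E1b_GKCohomologyU21_U8e_CDPseudoCoeffParts.lean`

Cell hodgecm-mathlib, Track B «K2-LIT», engine E1b; crux item h413 = stmt-HodgeConjecture-24833; dealer ∕ line author K2E1b-plan (g4); leaf filed VERBATIM by the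
defs desk K2-defs1 (g4) (K2-lead (g1) CHAIR RULING R19 «8a IN-HOUSE PARTS (LIMITED)», 2026-09-04T05:10:13Z; K2-lead RULING R3 (d) «DEFS BEFORE SIGS IS HARD»:
no `Theorems/` file may import a `Cruxes/…/Lines` module, so every `def` a U8e socket or its Theorems-side payer names lives in a ★ leaf FIRST).

THE TWO NOTIONS OF THE PRINTED THEOREM that the tree lacked.  Clozel–Delorme's corollary «Existence de pseudo-coefficients» [ClozelDelorme1990, Cor. p. 213]
produces, for a discrete-series representation `δ₀` of a connected reductive Lie group `G` (here `U(2,1)`, centre compact), a function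
`f ∈ C_c^∞(G, K)` — «l'espace des fonctions C^∞ à support compact K-finies à droite et à gauche sur G» [ClozelDelorme1990, §1 p. 194] — with
`tr δ₀(f) = 1` and `tr π(f) = 0` on every other basic representation; for such bi-`K`-finite `f` and an admissible `ϖ` the operator `ϖ(f)` has FINITE RANK,
and «`tr ϖ(f)`» is the trace of a finite-rank operator.  Unit U8's socket currency is the basis-free Hilbert-space trace ★ `HasArchOpTrace` («`Σ_k ⟪e_k, ϖ(f) e_k⟫ → c`
for EVERY Hilbert basis»); this leaf adds
* `IsLeftKFiniteU21 f` — the LEFT `K`-translates `λ(k) f` (★ `leftTranslate`, `K = U(2,1) ∩ U(3)` = ★ `maximalCompact`, included by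
  ★ `Subgroup.inclusion maximalCompact_le_carrier`) of `f : C_c(U(2,1), ℂ)` lie in one finite-dimensional subspace of `C(U(2,1), ℂ)` — the half of print's
  «bi-`K`-finite» that finite rank uses (LEFT pairs with a LEFT-invariant Haar measure: `ϖ(λ(k)f) = ϖ(k) ϖ(f)`; K2-defs1 (g4) census 2026-09-04T05:15:24Z (iii));
  the binder is token-for-token the hypothesis `hf` of brick «8a-1» `Theorems/K2E1bFiniteRankArchOpTrace.lean`;
* `HasFinRankOpTrace ν ϖ hu hsc f c` — «`ϖ(f)` has finite rank and finite-rank trace `c`»: SOME finite-dimensional subspace `W` contains the range of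
  `ϖ(f) = ϖ.integratedOperator hu hsc ν f` and the trace of the restriction `ϖ(f)|_W : W → W` is `c` (junk-free: the value does not depend on `W ⊇ range`,
  and for EVERY Hilbert basis the diagonal sum converges to it — that independence ∕ Parseval step is the M-sized brick «8a-1 FINITE-RANK TRACE»
  `Theorems/K2E1bFiniteRankArchOpTrace.lean`, not asserted here); generic topological group `G` and measure finite on compacta, same frame as ★ `HasArchOpTrace`;
* the 0-sorry API `hasFinRankOpTrace_iff`, `isLeftKFiniteU21_iff` (`Iff.rfl`) and `hasArchOpTrace_unique` (two basis-free traces of the same `ϖ(f)` agree —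
  `HasSum.unique` along ★ `exists_hilbertBasis`; the glue that runs the SUPPORT clause of socket 8a `CDPseudoCoeffWith` backwards from `HasArchOpTrace` to
  `HasFinRankOpTrace`).
Same namespace `…Cruxes.H413.K2E1bGKCohomologyU21.U8` as the U8 defs leaf; definitions + `Iff.rfl` ∕ uniqueness lemmas only; no `sorry`, no axiom beyond the
TRIO, no instance, no notation.
Sources (audited by the dealer against the held pages, CD90 = `paper:doi-10-24033-asens-1602`): [ClozelDelorme1990] §1 p. 194 (p0003.txt L15–16 «Notons C_c^∞(G, K)
l'espace des fonctions C^∞ à support compact K-finies à droite et à gauche sur G»), Cor. p. 213 (p0022.txt L5–9 «COROLLAIRE (Existence de pseudo-coefficients). —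
Soit δ₀ ∈ Ĝ_d. Alors, pour tout r > 0, il existe f ∈ C_c^∞(G, K)_r telle que (i) tr δ₀(f) = 1 (ii) tr π_{δ,ν}(f) = 0 pour toute représentation basique … différente
de δ₀»); [Knapp1986] Thm. 10.2 (distribution character = trace of `ϖ(f)`, trace class); [BorelWallach2000] 0 §2.5 (admissibility: `K`-isotypic subspaces of a
unitary globalization are finite-dimensional).

HONEST LABEL: HC_CM is proved only modulo the 7 printed citations (2 remaining named inputs: hLiu418 = stmt-HodgeConjecture-24832,
h413 = stmt-HodgeConjecture-24833) until rung 0 closes; this file asserts nothing (definitions + unfolding ∕ uniqueness lemmas only); count-neutral.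
-/

set_option autoImplicit false
set_option linter.dupNamespace false

noncomputable section

open NumberField MeasureTheory CompactlySupported
open scoped Matrix MatrixGroups InnerProductSpace ContDiff

namespace Summit.HodgeConjecture.HodgeConjecture.Cruxes.H413.K2E1bGKCohomologyU21.U8

open Literature.NumberTheory.Automorphic
open Literature.RepresentationTheory.KonnoKonno2007 Literature.RepresentationTheory.KonnoKonno2007.RealDualPair

/-! ## §1 Finite-rank traces (generic topological group) -/

section Generic

variable {G : Type*} [Group G] [TopologicalSpace G] [MeasurableSpace G] [BorelSpace G]

/-- **`ϖ(f)` has finite rank, with finite-rank trace `c`**: some finite-dimensional subspace `W ≤ E` contains the range of the integrated operator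
`ϖ(f) = ∫ f(g) ϖ(g) dν(g)` (★ `ContRepresentation.integratedOperator`), and the trace of the restricted endomorphism `ϖ(f)|_W : W → W`
(★ `LinearMap.trace`, ★ `LinearMap.restrict`) is `c`.  For bi-`K`-finite `f` and admissible `ϖ` this is print's «`tr ϖ(f)`»; the value is independent of
the choice of `W ⊇ range ϖ(f)` and is the sum `Σ_k ⟪e_k, ϖ(f) e_k⟫` over every Hilbert basis (brick «8a-1», not asserted here).
(ClozelDelorme1990, Cor. p. 213) (Knapp1986, Thm. 10.2) — a definitional predicate of the engine line (hence untagged). -/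
def HasFinRankOpTrace (ν : Measure G) [IsFiniteMeasureOnCompacts ν] {E : Type} [NormedAddCommGroup E] [InnerProductSpace ℂ E] [CompleteSpace E]
    (ϖ : ContRepresentation ℂ G E) (hu : ϖ.IsUnitary) (hsc : ϖ.IsStronglyContinuous) (f : C_c(G, ℂ)) (c : ℂ) : Prop :=
  ∃ W : Submodule ℂ E, FiniteDimensional ℂ W ∧ ∃ hW : ∀ v : E, ϖ.integratedOperator hu hsc ν f v ∈ W,
    LinearMap.trace ℂ W ((ϖ.integratedOperator hu hsc ν f).toLinearMap.restrict fun v (_ : v ∈ W) => hW v) = c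

/-- Unfolding `HasFinRankOpTrace`. [folklore] -/
theorem hasFinRankOpTrace_iff (ν : Measure G) [IsFiniteMeasureOnCompacts ν] {E : Type} [NormedAddCommGroup E]
    [InnerProductSpace ℂ E] [CompleteSpace E] (ϖ : ContRepresentation ℂ G E) (hu : ϖ.IsUnitary) (hsc : ϖ.IsStronglyContinuous)
    (f : C_c(G, ℂ)) (c : ℂ) :
    HasFinRankOpTrace ν ϖ hu hsc f c ↔
      ∃ W : Submodule ℂ E, FiniteDimensional ℂ W ∧ ∃ hW : ∀ v : E, ϖ.integratedOperator hu hsc ν f v ∈ W,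
        LinearMap.trace ℂ W ((ϖ.integratedOperator hu hsc ν f).toLinearMap.restrict fun v (_ : v ∈ W) => hW v) = c := Iff.rfl

/-- **The basis-free trace is unique**: two values `c₁, c₂` with `HasArchOpTrace ν ϖ hu hsc f cᵢ` agree (evaluate both `HasSum`s on one Hilbert basis,
★ `exists_hilbertBasis`, and use `HasSum.unique`). [folklore] -/
theorem hasArchOpTrace_unique (ν : Measure G) [IsFiniteMeasureOnCompacts ν] {E : Type} [NormedAddCommGroup E]
    [InnerProductSpace ℂ E] [CompleteSpace E] (ϖ : ContRepresentation ℂ G E) (hu : ϖ.IsUnitary) (hsc : ϖ.IsStronglyContinuous)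
    (f : C_c(G, ℂ)) {c₁ c₂ : ℂ} (h₁ : HasArchOpTrace ν ϖ hu hsc f c₁) (h₂ : HasArchOpTrace ν ϖ hu hsc f c₂) : c₁ = c₂ := by
  obtain ⟨w, b, -⟩ := exists_hilbertBasis ℂ E
  exact (h₁ w b).unique (h₂ w b)

end Generic

/-! ## §2 Left-`K`-finite test functions on `U(2,1)` -/

/-- **Left-`K`-finite functions on `U(2,1)`** (the left half of print's «K-finies à droite et à gauche»): the left translates `λ(k) f`
(★ `leftTranslate`, `(λ(k) f)(x) = f(k⁻¹ x)`), `k ∈ K = U(2,1) ∩ U(3)` (★ `RealMatrixGroup.maximalCompact`, included in the carrier by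
★ `Subgroup.inclusion maximalCompact_le_carrier`), all lie in ONE finite-dimensional subspace `F ≤ C(U(2,1), ℂ)`.
(ClozelDelorme1990, §1 p. 194; Cor. p. 213) (BorelJacquet1979, §1.3) — a definitional predicate of the engine line (hence untagged). -/
def IsLeftKFiniteU21 (f : C_c(↥(uFormGroup (Fin 2) (Fin 1)).carrier, ℂ)) : Prop :=
  ∃ F : Submodule ℂ C(↥(uFormGroup (Fin 2) (Fin 1)).carrier, ℂ), FiniteDimensional ℂ F ∧
    ∀ k : ↥(uFormGroup (Fin 2) (Fin 1)).maximalCompact,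
      leftTranslate (Subgroup.inclusion (uFormGroup (Fin 2) (Fin 1)).maximalCompact_le_carrier k) (f : C(↥(uFormGroup (Fin 2) (Fin 1)).carrier, ℂ)) ∈ F

/-- Unfolding `IsLeftKFiniteU21`. [folklore] -/
theorem isLeftKFiniteU21_iff (f : C_c(↥(uFormGroup (Fin 2) (Fin 1)).carrier, ℂ)) :
    IsLeftKFiniteU21 f ↔
      ∃ F : Submodule ℂ C(↥(uFormGroup (Fin 2) (Fin 1)).carrier, ℂ), FiniteDimensional ℂ F ∧
        ∀ k : ↥(uFormGroup (Fin 2) (Fin 1)).maximalCompact,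
          leftTranslate (Subgroup.inclusion (uFormGroup (Fin 2) (Fin 1)).maximalCompact_le_carrier k) (f : C(↥(uFormGroup (Fin 2) (Fin 1)).carrier, ℂ)) ∈ F :=
  Iff.rfl

end Summit.HodgeConjecture.HodgeConjecture.Cruxes.H413.K2E1bGKCohomologyU21.U8
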